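import Mathlib.Analysis.SpecificLimits.Normed
import Mathlib.Analysis.SpecialFunctions.Pow.Real
import Mathlib.Analysis.SpecialFunctions.Sqrt
import Mathlib.Topology.Algebra.InfiniteSum.ENNReal
import Mathlib.Algebra.Order.Chebyshev
import Literature.Analysis.FluidPDE.TaoWhitneyCover
import HarnessLib

/-!
# Tao (2011/2013), proof of Thm. 10.1: the parent-ball chaining behind the `Y₆` estimate

Support file for the proof of the nonlinear estimate `Y₆` of Tao's enstrophy localisation
argument (T. Tao, *Localisation and compactness properties of the Navier–Stokes global regularity
problem*, arXiv:1108.1165, §10, p. 33). After the Whitney decomposition and the local Sobolev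
inequality, the lower-order term `c^{-0.1}δ² Σᵢ rᵢ⁴ wᵢ³` (`wᵢ` the root-mean-square of `|ω|` on
`3Bᵢ`) is "trickier to handle", and Tao controls it by chaining every small Whitney ball to a
large ancestor: "for any small ball `Bᵢ`, we may assign a 'parent' ball `B_{p(i)}` which touches
the ball but has radius at least `1.001` as large as that of `Bᵢ`. We may iterate this until we
reach a large ball `B_{a(i)}`, and write `wᵢ ≤ w_{a(i)} + Σ_{k≥0}|w_{p^k(i)} − w_{p^{k+1}(i)}|`
[…] Taking cubes and using Hölder's inequality […] `wᵢ³ ≲ w_{a(i)}³ + Σ_k (1+k)^{10}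
|w_{p^k(i)} − w_{p^{k+1}(i)}|³` […] If one fixes a large ball `Bⱼ`, one easily checks that
`Σ_{i:a(i)=j} rᵢ⁴ ≲ rⱼ⁴` […] Similarly, if one fixes a small ball `Bⱼ`, one verifies that
`Σ_k (1+k)^{10} Σ_{i:p^k(i)=j} rᵢ⁴ ≲ rⱼ⁴`".

This file isolates the **combinatorics** of that passage from the analysis (no Navier–Stokes, no
measure theory beyond `ℝ≥0∞`-valued sums), over an abstract index type with a parent map
`p : ι → ι`, a set `big` of terminal ("large") indices and weights `M` ("`rᵢ⁴`"):

* `WhitneyChain.pow_three_sum_range_le` — the cube step with explicit polynomial weights,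
  `(Σ_{i<n} aᵢ)³ ≤ Σ_{i<n} (i+2)⁴aᵢ³` (two Cauchy–Schwarz inequalities with the telescoping weights
  `1/((i+1)(i+2))`; Tao's "Hölder" with `(1+k)^{10}`);
* `WhitneyChain.le_iterate_add_sum_chainStep` — the telescoping `wᵢ ≤ w_{a(i)} + Σ|Δw|`;
* `WhitneyChain.gen'`, `exists_iterate_mem` — chains along which the radii grow geometrically
  terminate (the generation / ancestor of an index);
* `WhitneyChain.tsum_small_le_of_chain` — **the abstract chain inequality**
  `Σ_{small} M·m³ ≤ 8C₀ Σ_{big} M·m³ + 8C₁ Σ_{small} M·|m − m∘p|³` under the two effective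
  packing bounds, obtained (`pack_ancestor`, `pack_descendant`) from a per-generation packing
  bound `Σ_{x : pʲx = z} M x ≤ C ϑʲ M z` with `ϑ < 1`, whose two series are finite
  (`tsum_geometric_lt_top`, `tsum_pow_four_mul_geometric_lt_top`);
* `tsum_pow_four_chain_le` — **the per-generation packing for Whitney families** in dimension
  `3`: if the quarter balls are disjoint (`IsWhitneyFamily`, `TaoWhitneyCover.lean`), the radii
  grow by `1 + θ` along parent steps and parents are `K₁ρ`-close, then
  `Σ_{x : pʲx = z} ρ(x)⁴ ≤ (4K₁/θ + 5)³ (1+θ)^{-j} ρ(z)⁴` (the chain stays in `B(z, (K₁/θ+1)ρ(z))`,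
  `chain_radius_dist_le`, and the packing bound `tsum_pow_radius_le`).

## Mathlib / tree search

Nothing of this kind in Mathlib or the tree (`lean search 'chain.*parent|Whitney.*chain|gen'`);
used: `Finset.sum_mul_sq_le_sq_mul_sq` (Cauchy–Schwarz), `ENNReal.tsum_comm`, `tsum_ite_eq`,
`ENNReal.tsum_geometric`, `summable_pow_mul_geometric_of_norm_lt_one`, `pow_unbounded_of_one_lt`,
and the tree's `tsum_pow_radius_le` (`TaoWhitneyCover`).

## References

* T. Tao, *Localisation and compactness properties of the Navier–Stokes global regularity
  problem*, Anal. PDE 6 (2013) 25–107 = arXiv:1108.1165 (`Tao2011`), §10, proof of Thm. 10.1,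
  p. 33 (the parent-ball chaining).
-/

noncomputable section

open Set Function Filter Finset
open scoped ENNReal NNReal Topology

namespace Literature.Analysis.FluidPDE


namespace WhitneyChain

/-! ## A weighted cube inequality for finite sums -/

/-- **`(Σᵢ aᵢ)³ ≤ Σᵢ aᵢ³/πᵢ²` for nonnegative reals when `Σᵢ πᵢ ≤ 1`, `πᵢ > 0`** (two
applications of the Cauchy–Schwarz inequality: `(Σa)² ≤ Σa²/π` and
`Σa²/π ≤ (Σa)^{1/2}(Σa³/π²)^{1/2}`). [folklore] -/
theorem pow_three_sum_le_sum_div_sq {ι : Type*} (s : Finset ι) {a π : ι → ℝ}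
    (ha : ∀ i ∈ s, 0 ≤ a i) (hπ : ∀ i ∈ s, 0 < π i) (hπ1 : ∑ i ∈ s, π i ≤ 1) :
    (∑ i ∈ s, a i) ^ 3 ≤ ∑ i ∈ s, a i ^ 3 / π i ^ 2 := by
  set S := ∑ i ∈ s, a i with hS
  set Q := ∑ i ∈ s, a i ^ 2 / π i with hQ
  set T := ∑ i ∈ s, a i ^ 3 / π i ^ 2 with hT
  have hS0 : 0 ≤ S := Finset.sum_nonneg ha
  have hQ0 : 0 ≤ Q := Finset.sum_nonneg fun i hi => div_nonneg (sq_nonneg _) (hπ i hi).le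
  have hT0 : 0 ≤ T := Finset.sum_nonneg fun i hi =>
    div_nonneg (pow_nonneg (ha i hi) 3) (sq_nonneg _)
  -- first Cauchy–Schwarz: `S² ≤ (Σ π) Q ≤ Q`
  have h1 : S ^ 2 ≤ Q := by
    have hcs := Finset.sum_mul_sq_le_sq_mul_sq s (fun i => Real.sqrt (π i))
      (fun i => a i / Real.sqrt (π i))
    have e1 : ∀ i ∈ s, Real.sqrt (π i) * (a i / Real.sqrt (π i)) = a i := fun i hi => by
      field_simp [(Real.sqrt_pos.2 (hπ i hi)).ne']
    have e2 : ∀ i ∈ s, Real.sqrt (π i) ^ 2 = π i := fun i hi => Real.sq_sqrt (hπ i hi).le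
    have e3 : ∀ i ∈ s, (a i / Real.sqrt (π i)) ^ 2 = a i ^ 2 / π i := fun i hi => by
      rw [div_pow, Real.sq_sqrt (hπ i hi).le]
    rw [Finset.sum_congr rfl e1, Finset.sum_congr rfl e2, Finset.sum_congr rfl e3] at hcs
    calc S ^ 2 ≤ (∑ i ∈ s, π i) * Q := hcs
      _ ≤ 1 * Q := mul_le_mul_of_nonneg_right hπ1 hQ0
      _ = Q := one_mul Q
  -- second Cauchy–Schwarz: `Q² ≤ S T`
  have h2 : Q ^ 2 ≤ S * T := by
    have hcs := Finset.sum_mul_sq_le_sq_mul_sq s (fun i => Real.sqrt (a i))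
      (fun i => a i * Real.sqrt (a i) / π i)
    have e1 : ∀ i ∈ s, Real.sqrt (a i) * (a i * Real.sqrt (a i) / π i) = a i ^ 2 / π i :=
      fun i hi => by
        rw [mul_div_assoc', show Real.sqrt (a i) * (a i * Real.sqrt (a i)) =
          a i * (Real.sqrt (a i) * Real.sqrt (a i)) by ring, Real.mul_self_sqrt (ha i hi), sq]
    have e2 : ∀ i ∈ s, Real.sqrt (a i) ^ 2 = a i := fun i hi => Real.sq_sqrt (ha i hi)
    have e3 : ∀ i ∈ s, (a i * Real.sqrt (a i) / π i) ^ 2 = a i ^ 3 / π i ^ 2 := fun i hi => by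
      rw [div_pow, mul_pow, Real.sq_sqrt (ha i hi)]
      ring
    rw [Finset.sum_congr rfl e1, Finset.sum_congr rfl e2, Finset.sum_congr rfl e3] at hcs
    exact hcs
  -- combine: `S⁴ ≤ Q² ≤ S T`, so `S³ ≤ T`
  have h3 : S ^ 4 ≤ S * T := by
    calc S ^ 4 = (S ^ 2) ^ 2 := by ring
      _ ≤ Q ^ 2 := pow_le_pow_left₀ (sq_nonneg _) h1 2
      _ ≤ S * T := h2
  rcases hS0.eq_or_lt with h0 | hpos
  · rw [← h0]
    simpa using hT0
  · have : S ^ 3 * S ≤ T * S := by nlinarith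
    exact le_of_mul_le_mul_right this hpos

/-- The telescoping weights `πᵢ = 1/((i+1)(i+2))` sum to at most `1`. [folklore] -/
theorem sum_range_inv_mul_succ_le_one (n : ℕ) :
    ∑ i ∈ Finset.range n, (1 : ℝ) / (((i : ℝ) + 1) * ((i : ℝ) + 2)) ≤ 1 := by
  have h : ∀ n : ℕ, ∑ i ∈ Finset.range n, (1 : ℝ) / (((i : ℝ) + 1) * ((i : ℝ) + 2)) =
      1 - 1 / ((n : ℝ) + 1) := by
    intro n
    induction n with
    | zero => simp
    | succ n ih =>
      rw [Finset.sum_range_succ, ih]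
      push_cast
      field_simp
      ring
  rw [h n]
  have : 0 < 1 / ((n : ℝ) + 1) := by positivity
  linarith

/-- **The chain inequality, real form**: `(Σ_{i<n} aᵢ)³ ≤ Σ_{i<n} (i+2)⁴ aᵢ³` for `aᵢ ≥ 0`
(Tao 2011, p. 33: "Taking cubes and using Hölder's inequality, we obtain
`wᵢ³ ≲ w_{a(i)}³ + Σ_k (1+k)^{10}|w_{p^k(i)} − w_{p^{k+1}(i)}|³`"). [cite: Tao2011, §10, proof of Thm. 10.1 (parent-ball chaining, p. 33)] -/
theorem pow_three_sum_range_le {a : ℕ → ℝ} (ha : ∀ i, 0 ≤ a i) (n : ℕ) :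
    (∑ i ∈ Finset.range n, a i) ^ 3 ≤ ∑ i ∈ Finset.range n, ((i : ℝ) + 2) ^ 4 * a i ^ 3 := by
  have h := pow_three_sum_le_sum_div_sq (Finset.range n) (a := a)
    (π := fun i => (1 : ℝ) / (((i : ℝ) + 1) * ((i : ℝ) + 2))) (fun i _ => ha i)
    (fun i _ => by positivity) (sum_range_inv_mul_succ_le_one n)
  refine h.trans (Finset.sum_le_sum fun i _ => ?_)
  rw [div_le_iff₀ (by positivity)]
  have ha3 : 0 ≤ a i ^ 3 := pow_nonneg (ha i) 3
  have key : (1 : ℝ) ≤ ((i : ℝ) + 2) ^ 4 * ((1 : ℝ) / (((i : ℝ) + 1) * ((i : ℝ) + 2))) ^ 2 := by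
    rw [div_pow, one_pow, mul_one_div, le_div_iff₀ (by positivity), one_mul]
    have : ((i : ℝ) + 1) * ((i : ℝ) + 2) ≤ ((i : ℝ) + 2) ^ 2 := by nlinarith
    calc (((i : ℝ) + 1) * ((i : ℝ) + 2)) ^ 2 ≤ (((i : ℝ) + 2) ^ 2) ^ 2 :=
          pow_le_pow_left₀ (by positivity) this 2
      _ = ((i : ℝ) + 2) ^ 4 := by ring
  calc a i ^ 3 = a i ^ 3 * 1 := (mul_one _).symm
    _ ≤ a i ^ 3 * (((i : ℝ) + 2) ^ 4 * ((1 : ℝ) / (((i : ℝ) + 1) * ((i : ℝ) + 2))) ^ 2) :=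
        mul_le_mul_of_nonneg_left key ha3
    _ = ((i : ℝ) + 2) ^ 4 * a i ^ 3 * ((1 : ℝ) / (((i : ℝ) + 1) * ((i : ℝ) + 2))) ^ 2 := by ring

/-- **The chain inequality in `ℝ≥0∞`**: `(Σ_{i<n} Dᵢ)³ ≤ Σ_{i<n} (i+2)⁴ Dᵢ³`. [folklore] -/
theorem pow_three_sum_range_le_ennreal (D : ℕ → ℝ≥0∞) (n : ℕ) :
    (∑ i ∈ Finset.range n, D i) ^ 3 ≤ ∑ i ∈ Finset.range n, ((i : ℝ≥0∞) + 2) ^ 4 * D i ^ 3 := by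
  by_cases htop : ∃ i ∈ Finset.range n, D i = ⊤
  · obtain ⟨i, hi, hD⟩ := htop
    refine le_trans le_top (le_of_eq ?_)
    symm
    rw [ENNReal.sum_eq_top]
    refine ⟨i, hi, ?_⟩
    rw [hD, ENNReal.top_pow (by norm_num)]
    exact ENNReal.mul_top (by positivity)
  · push Not at htop
    -- all finite: pass to `ℝ≥0`
    set d : ℕ → ℝ≥0 := fun i => (D i).toNNReal with hd
    have hDd : ∀ i ∈ Finset.range n, D i = (d i : ℝ≥0∞) := fun i hi => (ENNReal.coe_toNNReal (htop i hi)).symm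
    have hreal := pow_three_sum_range_le (a := fun i => (d i : ℝ)) (fun i => (d i).coe_nonneg) n
    have h1 : ((∑ i ∈ Finset.range n, (d i : ℝ)) ^ 3 : ℝ) ≤
        ∑ i ∈ Finset.range n, ((i : ℝ) + 2) ^ 4 * (d i : ℝ) ^ 3 := hreal
    have h2 : (∑ i ∈ Finset.range n, d i) ^ 3 ≤ ∑ i ∈ Finset.range n, ((i : ℝ≥0) + 2) ^ 4 * d i ^ 3 := by
      rw [← NNReal.coe_le_coe]
      push_cast
      exact h1
    calc (∑ i ∈ Finset.range n, D i) ^ 3 = (∑ i ∈ Finset.range n, (d i : ℝ≥0∞)) ^ 3 := by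
          rw [Finset.sum_congr rfl hDd]
      _ = (((∑ i ∈ Finset.range n, d i) ^ 3 : ℝ≥0) : ℝ≥0∞) := by push_cast; rfl
      _ ≤ ((∑ i ∈ Finset.range n, ((i : ℝ≥0) + 2) ^ 4 * d i ^ 3 : ℝ≥0) : ℝ≥0∞) := by
          exact_mod_cast h2
      _ = ∑ i ∈ Finset.range n, ((i : ℝ≥0∞) + 2) ^ 4 * (d i : ℝ≥0∞) ^ 3 := by push_cast; rfl
      _ = ∑ i ∈ Finset.range n, ((i : ℝ≥0∞) + 2) ^ 4 * D i ^ 3 :=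
          Finset.sum_congr rfl fun i hi => by rw [hDd i hi]


/-! ## The abstract parent-chain inequality -/

section Chain

variable {ι : Type*} (p : ι → ι) (big : Set ι) (gen : ι → ℕ)

/-- The increment of `m` along one parent step, `|m(x) − m(p x)|` in `ℝ≥0∞`
(truncated subtractions in both orders). [folklore] -/
def chainStep (m : ι → ℝ≥0∞) (x : ι) : ℝ≥0∞ := (m x - m (p x)) + (m (p x) - m x)

/-- Unfolding `chainStep`. [folklore] -/
theorem chainStep_def (m : ι → ℝ≥0∞) (x : ι) :
    chainStep p m x = (m x - m (p x)) + (m (p x) - m x) := rfl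

/-- One step: `m(x) ≤ m(p x) + |m(x) − m(p x)|`. [folklore] -/
theorem le_add_chainStep (m : ι → ℝ≥0∞) (x : ι) : m x ≤ m (p x) + chainStep p m x := by
  rw [chainStep_def]
  calc m x ≤ (m x - m (p x)) + m (p x) := le_tsub_add
    _ = m (p x) + (m x - m (p x)) := add_comm _ _
    _ ≤ m (p x) + ((m x - m (p x)) + (m (p x) - m x)) := add_le_add le_rfl le_self_add

/-- **Telescoping along the chain**: `m(x) ≤ m(pⁿ x) + Σ_{i<n} |m(pⁱx) − m(pⁱ⁺¹x)|`
(Tao 2011, p. 33: "`wᵢ ≤ w_{a(i)} + Σ_{k≥0} |w_{p^k(i)} − w_{p^{k+1}(i)}|`"). [cite: Tao2011, §10, proof of Thm. 10.1 (parent-ball chaining, p. 33)] -/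
theorem le_iterate_add_sum_chainStep (m : ι → ℝ≥0∞) (n : ℕ) (x : ι) :
    m x ≤ m (p^[n] x) + ∑ i ∈ Finset.range n, chainStep p m (p^[i] x) := by
  induction n generalizing x with
  | zero => simp
  | succ n ih =>
    rw [Finset.sum_range_succ', Function.iterate_succ_apply]
    calc m x ≤ m (p x) + chainStep p m x := le_add_chainStep p m x
      _ ≤ (m (p^[n] (p x)) + ∑ i ∈ Finset.range n, chainStep p m (p^[i] (p x))) +
          chainStep p m x := add_le_add (ih (p x)) le_rfl
      _ = m (p^[n] (p x)) + (∑ i ∈ Finset.range n, chainStep p m (p^[i + 1] x) +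
          chainStep p m (p^[0] x)) := by
          simp only [Function.iterate_succ_apply, Function.iterate_zero, id_eq]
          ring

/-- `(a + b)³ ≤ 8(a³ + b³)` in `ℝ≥0∞`. [folklore] -/
theorem add_pow_three_le (a b : ℝ≥0∞) : (a + b) ^ 3 ≤ 8 * (a ^ 3 + b ^ 3) := by
  have h1 : a + b ≤ 2 * max a b := by
    rw [two_mul]; exact add_le_add (le_max_left _ _) (le_max_right _ _)
  have h2 : (max a b) ^ 3 ≤ a ^ 3 + b ^ 3 := by
    rcases le_total a b with h | h
    · rw [max_eq_right h]; exact le_add_left le_rfl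
    · rw [max_eq_left h]; exact le_add_right le_rfl
  calc (a + b) ^ 3 ≤ (2 * max a b) ^ 3 := pow_le_pow_left₀ bot_le h1 3
    _ = 8 * (max a b) ^ 3 := by rw [mul_pow]; norm_num
    _ ≤ 8 * (a ^ 3 + b ^ 3) := mul_le_mul' le_rfl h2

/-! ### Termination of the chains and the generation function -/

/-- **Chains terminate**: if the radii are positive, bounded by `R`, and grow by the factor
`1 + θ > 1` along each parent step out of `big`, then every chain `x, p x, p² x, …` enters
`big`. [folklore] -/
theorem exists_iterate_mem {ρ : ι → ℝ} {R θ : ℝ} (hθ : 0 < θ) (hpos : ∀ x, 0 < ρ x)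
    (hR : ∀ x, ρ x ≤ R) (hgrow : ∀ x, x ∉ big → (1 + θ) * ρ x ≤ ρ (p x)) (x : ι) :
    ∃ n, p^[n] x ∈ big := by
  by_contra h
  push Not at h
  have hind : ∀ n : ℕ, (1 + θ) ^ n * ρ x ≤ ρ (p^[n] x) := by
    intro n
    induction n with
    | zero => simp
    | succ n ih =>
      rw [Function.iterate_succ_apply', pow_succ]
      calc (1 + θ) ^ n * (1 + θ) * ρ x = (1 + θ) * ((1 + θ) ^ n * ρ x) := by ring
        _ ≤ (1 + θ) * ρ (p^[n] x) := mul_le_mul_of_nonneg_left ih (by linarith)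
        _ ≤ ρ (p (p^[n] x)) := hgrow _ (h n)
  -- `(1+θ)^n → ∞`
  obtain ⟨n, hn⟩ := pow_unbounded_of_one_lt (R / ρ x) (by linarith : (1 : ℝ) < 1 + θ)
  have h1 := (hind n).trans (hR _)
  rw [div_lt_iff₀ (hpos x)] at hn
  linarith

/-- The **generation** of `x`: the first time the chain `x, p x, p² x, …` enters `big`
(Tao's ancestor `a(i) = p^{gen}(i)`, p. 33). [cite: Tao2011, §10, proof of Thm. 10.1 (parent-ball chaining, p. 33)] -/
def gen' [DecidablePred (· ∈ big)] (hterm : ∀ x, ∃ n, p^[n] x ∈ big) (x : ι) : ℕ :=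
  Nat.find (hterm x)

/-- The chain enters `big` at its generation. [folklore] -/
theorem iterate_gen'_mem [DecidablePred (· ∈ big)] (hterm : ∀ x, ∃ n, p^[n] x ∈ big)
    (x : ι) : p^[gen' p big hterm x] x ∈ big :=
  Nat.find_spec (hterm x)

/-- Before its generation the chain stays out of `big`. [folklore] -/
theorem iterate_notMem_of_lt_gen' [DecidablePred (· ∈ big)]
    (hterm : ∀ x, ∃ n, p^[n] x ∈ big) (x : ι) (i : ℕ) (hi : i < gen' p big hterm x) :
    p^[i] x ∉ big :=
  Nat.find_min (hterm x) hi

variable {p big gen}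

/-- If `x` is big then its generation is `0`. [folklore] -/
theorem gen_eq_zero_of_mem (hgen1 : ∀ x i, i < gen x → p^[i] x ∉ big) {x : ι} (hx : x ∈ big) :
    gen x = 0 := by
  by_contra h
  exact hgen1 x 0 (Nat.pos_of_ne_zero h) (by simpa using hx)

/-- **The abstract parent-chain inequality** (the combinatorial core of Tao 2011, p. 33). Let
`p : ι → ι` ("parent"), `big ⊆ ι`, and `gen : ι → ℕ` the generation at which the chain
`x, p x, p² x, …` first enters `big` (`p^{gen x} x ∈ big`, earlier iterates not in `big`); let
`M ≥ 0` be weights ("`rᵢ⁴`") satisfying the two effective packing bounds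
`Σ_{x small, p^{gen x}x = z} M x ≤ C₀ M z` and `Σ_x Σ_{i < gen x, pⁱx = w} (i+2)⁴ M x ≤ C₁ M w`.
Then for every `m ≥ 0` ("the averages `wᵢ`"),
`Σ_{x small} M x · m(x)³ ≤ 8C₀ Σ_{z big} M z · m(z)³ + 8C₁ Σ_{w small} M w · |m(w) − m(p w)|³`
(telescoping, `(Σ_{i<n}Dᵢ)³ ≤ Σ(i+2)⁴Dᵢ³`, and regrouping the double sums by the ancestor). [cite: Tao2011, §10, proof of Thm. 10.1 (parent-ball chaining, p. 33)] -/
theorem tsum_small_le_of_chain [DecidableEq ι] [DecidablePred (· ∈ big)] (hgen0 : ∀ x, p^[gen x] x ∈ big)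
    (hgen1 : ∀ x i, i < gen x → p^[i] x ∉ big) {M : ι → ℝ≥0∞} {C₀ C₁ : ℝ≥0∞}
    (hpack0 : ∀ z, ∑' x, (if p^[gen x] x = z ∧ x ∉ big then M x else 0) ≤ C₀ * M z)
    (hpack1 : ∀ w, ∑' x, ∑' i : ℕ, (if p^[i] x = w ∧ i < gen x then ((i : ℝ≥0∞) + 2) ^ 4 * M x
      else 0) ≤ C₁ * M w)
    (m : ι → ℝ≥0∞) :
    ∑' x, (if x ∈ big then 0 else M x * m x ^ 3) ≤
      8 * C₀ * ∑' z, (if z ∈ big then M z * m z ^ 3 else 0) +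
        8 * C₁ * ∑' w, (if w ∈ big then 0 else M w * chainStep p m w ^ 3) := by
  -- pointwise: cube of the telescoped bound
  have hpt : ∀ x, x ∉ big → M x * m x ^ 3 ≤
      8 * (M x * m (p^[gen x] x) ^ 3) +
        8 * ∑ i ∈ Finset.range (gen x), ((i : ℝ≥0∞) + 2) ^ 4 * (M x * chainStep p m (p^[i] x) ^ 3) := by
    intro x _
    have h1 := le_iterate_add_sum_chainStep p m (gen x) x
    have h2 := pow_three_sum_range_le_ennreal (fun i => chainStep p m (p^[i] x)) (gen x)
    calc M x * m x ^ 3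
        ≤ M x * (8 * (m (p^[gen x] x) ^ 3 +
            (∑ i ∈ Finset.range (gen x), chainStep p m (p^[i] x)) ^ 3)) :=
          mul_le_mul' le_rfl ((pow_le_pow_left₀ bot_le h1 3).trans (add_pow_three_le _ _))
      _ ≤ M x * (8 * (m (p^[gen x] x) ^ 3 +
            ∑ i ∈ Finset.range (gen x), ((i : ℝ≥0∞) + 2) ^ 4 * chainStep p m (p^[i] x) ^ 3)) := by
          gcongr
      _ = 8 * (M x * m (p^[gen x] x) ^ 3) +
          8 * ∑ i ∈ Finset.range (gen x), ((i : ℝ≥0∞) + 2) ^ 4 *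
            (M x * chainStep p m (p^[i] x) ^ 3) := by
          rw [mul_add, mul_add, Finset.mul_sum, Finset.mul_sum, Finset.mul_sum]
          congr 1
          · ring
          · refine Finset.sum_congr rfl fun i _ => ?_
            ring
  -- sum the pointwise bound
  have step1 : ∑' x, (if x ∈ big then 0 else M x * m x ^ 3) ≤
      8 * ∑' x, (if x ∈ big then 0 else M x * m (p^[gen x] x) ^ 3) +
        8 * ∑' x, (if x ∈ big then 0 else ∑ i ∈ Finset.range (gen x),
          ((i : ℝ≥0∞) + 2) ^ 4 * (M x * chainStep p m (p^[i] x) ^ 3)) := by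
    rw [← ENNReal.tsum_mul_left, ← ENNReal.tsum_mul_left, ← ENNReal.tsum_add]
    refine ENNReal.tsum_le_tsum fun x => ?_
    by_cases hx : x ∈ big
    · simp [hx]
    · simp only [if_neg hx]
      exact hpt x hx
  -- term 1: regroup by the ancestor `z = p^{gen x} x ∈ big`
  have term1 : ∑' x, (if x ∈ big then 0 else M x * m (p^[gen x] x) ^ 3) ≤
      C₀ * ∑' z, (if z ∈ big then M z * m z ^ 3 else 0) := by
    have e1 : ∀ x, (if x ∈ big then 0 else M x * m (p^[gen x] x) ^ 3) =
        ∑' z, (if z ∈ big then (if p^[gen x] x = z ∧ x ∉ big then M x else 0) * m z ^ 3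
          else 0) := by
      intro x
      rw [← tsum_ite_eq (p^[gen x] x) (fun z => if x ∈ big then 0 else M x * m z ^ 3)]
      refine tsum_congr fun z => ?_
      by_cases hz : z = p^[gen x] x
      · subst hz
        rw [if_pos rfl, if_pos (hgen0 x)]
        by_cases hx : x ∈ big
        · simp [hx]
        · simp [hx]
      · rw [if_neg hz]
        have : ¬ (p^[gen x] x = z ∧ x ∉ big) := fun h => hz h.1.symm
        simp [this]
    simp_rw [e1]
    rw [ENNReal.tsum_comm, ← ENNReal.tsum_mul_left]
    refine ENNReal.tsum_le_tsum fun z => ?_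
    by_cases hz : z ∈ big
    · simp only [if_pos hz]
      rw [ENNReal.tsum_mul_right, ← mul_assoc]
      exact mul_le_mul' (hpack0 z) le_rfl
    · simp [hz]
  -- term 2: regroup by `w = pⁱ x`, `i < gen x` (so `w` is small)
  have term2 : ∑' x, (if x ∈ big then 0 else ∑ i ∈ Finset.range (gen x),
      ((i : ℝ≥0∞) + 2) ^ 4 * (M x * chainStep p m (p^[i] x) ^ 3)) ≤
      C₁ * ∑' w, (if w ∈ big then 0 else M w * chainStep p m w ^ 3) := by
    have e1 : ∀ x, (if x ∈ big then 0 else ∑ i ∈ Finset.range (gen x),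
        ((i : ℝ≥0∞) + 2) ^ 4 * (M x * chainStep p m (p^[i] x) ^ 3)) =
        ∑' i : ℕ, ∑' w, (if w ∈ big then 0 else
          (if p^[i] x = w ∧ i < gen x then ((i : ℝ≥0∞) + 2) ^ 4 * M x else 0) *
            chainStep p m w ^ 3) := by
      intro x
      have hfin : ∀ i, ∑' w, (if w ∈ big then 0 else
          (if p^[i] x = w ∧ i < gen x then ((i : ℝ≥0∞) + 2) ^ 4 * M x else 0) *
            chainStep p m w ^ 3) =
          if i < gen x then ((i : ℝ≥0∞) + 2) ^ 4 * (M x * chainStep p m (p^[i] x) ^ 3) else 0 := by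
        intro i
        rw [← tsum_ite_eq (p^[i] x) (fun w => if i < gen x then
          ((i : ℝ≥0∞) + 2) ^ 4 * (M x * chainStep p m w ^ 3) else 0)]
        refine tsum_congr fun w => ?_
        by_cases hw : w = p^[i] x
        · subst hw
          by_cases hi : i < gen x
          · rw [if_neg (hgen1 x i hi), if_pos ⟨rfl, hi⟩, if_pos rfl, if_pos hi]
            ring
          · have : ¬ (p^[i] x = p^[i] x ∧ i < gen x) := fun h => hi h.2
            rw [if_neg this, if_pos rfl, if_neg hi]
            simp
        · have : ¬ (p^[i] x = w ∧ i < gen x) := fun h => hw h.1.symm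
          rw [if_neg this, if_neg hw]
          simp
      simp_rw [hfin]
      by_cases hx : x ∈ big
      · rw [if_pos hx, gen_eq_zero_of_mem hgen1 hx]
        simp
      · rw [if_neg hx, tsum_eq_sum (s := Finset.range (gen x))]
        · exact Finset.sum_congr rfl fun i hi => by rw [if_pos (Finset.mem_range.1 hi)]
        · intro i hi
          rw [if_neg (by simpa using hi)]
    simp_rw [e1]
    -- now swap the sums: `Σ_x Σ_i Σ_w = Σ_w Σ_x Σ_i`
    have hsw : ∀ x, (∑' i : ℕ, ∑' w, (if w ∈ big then 0 else
        (if p^[i] x = w ∧ i < gen x then ((i : ℝ≥0∞) + 2) ^ 4 * M x else 0) *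
          chainStep p m w ^ 3)) =
        ∑' w, ∑' i : ℕ, (if w ∈ big then 0 else
          (if p^[i] x = w ∧ i < gen x then ((i : ℝ≥0∞) + 2) ^ 4 * M x else 0) *
            chainStep p m w ^ 3) := fun x => ENNReal.tsum_comm
    simp_rw [hsw]
    rw [ENNReal.tsum_comm, ← ENNReal.tsum_mul_left]
    refine ENNReal.tsum_le_tsum fun w => ?_
    by_cases hw : w ∈ big
    · simp [hw]
    · simp only [if_neg hw]
      simp_rw [ENNReal.tsum_mul_right]
      rw [← mul_assoc]
      exact mul_le_mul' (hpack1 w) le_rfl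
  calc ∑' x, (if x ∈ big then 0 else M x * m x ^ 3)
      ≤ 8 * ∑' x, (if x ∈ big then 0 else M x * m (p^[gen x] x) ^ 3) +
        8 * ∑' x, (if x ∈ big then 0 else ∑ i ∈ Finset.range (gen x),
          ((i : ℝ≥0∞) + 2) ^ 4 * (M x * chainStep p m (p^[i] x) ^ 3)) := step1
    _ ≤ 8 * (C₀ * ∑' z, (if z ∈ big then M z * m z ^ 3 else 0)) +
        8 * (C₁ * ∑' w, (if w ∈ big then 0 else M w * chainStep p m w ^ 3)) :=
        add_le_add (mul_le_mul' le_rfl term1) (mul_le_mul' le_rfl term2)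
    _ = 8 * C₀ * ∑' z, (if z ∈ big then M z * m z ^ 3 else 0) +
        8 * C₁ * ∑' w, (if w ∈ big then 0 else M w * chainStep p m w ^ 3) := by ring

/-! ### From per-generation packing to the two effective packing bounds -/

/-- **Effective packing, ancestors**: from `Σ_{x : pʲx = z, j ≤ gen x} M x ≤ C ϑʲ M z` for all
`j` one gets `Σ_{x small : p^{gen x} x = z} M x ≤ C (Σⱼ ϑʲ) M z`. [folklore] -/
theorem pack_ancestor [DecidableEq ι] [DecidablePred (· ∈ big)] {M : ι → ℝ≥0∞} {C ϑ : ℝ≥0∞}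
    (hpack : ∀ z j, ∑' x, (if p^[j] x = z ∧ j ≤ gen x then M x else 0) ≤ C * ϑ ^ j * M z)
    (z : ι) :
    ∑' x, (if p^[gen x] x = z ∧ x ∉ big then M x else 0) ≤ (C * ∑' j : ℕ, ϑ ^ j) * M z := by
  have h1 : ∀ x, (if p^[gen x] x = z ∧ x ∉ big then M x else 0) ≤
      ∑' j : ℕ, (if p^[j] x = z ∧ j ≤ gen x then (if j = gen x then M x else 0) else 0) := by
    intro x
    by_cases hx : p^[gen x] x = z ∧ x ∉ big
    · rw [if_pos hx]
      refine le_trans (le_of_eq ?_) (ENNReal.le_tsum (gen x))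
      rw [if_pos ⟨hx.1, le_rfl⟩, if_pos rfl]
    · rw [if_neg hx]
      exact bot_le
  calc ∑' x, (if p^[gen x] x = z ∧ x ∉ big then M x else 0)
      ≤ ∑' x, ∑' j : ℕ, (if p^[j] x = z ∧ j ≤ gen x then (if j = gen x then M x else 0) else 0) :=
        ENNReal.tsum_le_tsum h1
    _ = ∑' j : ℕ, ∑' x, (if p^[j] x = z ∧ j ≤ gen x then (if j = gen x then M x else 0) else 0) :=
        ENNReal.tsum_comm
    _ ≤ ∑' j : ℕ, ∑' x, (if p^[j] x = z ∧ j ≤ gen x then M x else 0) := by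
        refine ENNReal.tsum_le_tsum fun j => ENNReal.tsum_le_tsum fun x => ?_
        split_ifs <;> simp
    _ ≤ ∑' j : ℕ, C * ϑ ^ j * M z := ENNReal.tsum_le_tsum fun j => hpack z j
    _ = (C * ∑' j : ℕ, ϑ ^ j) * M z := by
        rw [ENNReal.tsum_mul_right, ENNReal.tsum_mul_left]

/-- **Effective packing, descendants**: from the per-generation packing one gets
`Σ_x Σ_{i < gen x, pⁱx = w} (i+2)⁴ M x ≤ C (Σᵢ (i+2)⁴ϑⁱ) M w`. [folklore] -/
theorem pack_descendant [DecidableEq ι] {M : ι → ℝ≥0∞} {C ϑ : ℝ≥0∞}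
    (hpack : ∀ z j, ∑' x, (if p^[j] x = z ∧ j ≤ gen x then M x else 0) ≤ C * ϑ ^ j * M z)
    (w : ι) :
    ∑' x, ∑' i : ℕ, (if p^[i] x = w ∧ i < gen x then ((i : ℝ≥0∞) + 2) ^ 4 * M x else 0) ≤
      (C * ∑' i : ℕ, ((i : ℝ≥0∞) + 2) ^ 4 * ϑ ^ i) * M w := by
  rw [ENNReal.tsum_comm]
  calc ∑' i : ℕ, ∑' x, (if p^[i] x = w ∧ i < gen x then ((i : ℝ≥0∞) + 2) ^ 4 * M x else 0)
      ≤ ∑' i : ℕ, ((i : ℝ≥0∞) + 2) ^ 4 * ∑' x, (if p^[i] x = w ∧ i ≤ gen x then M x else 0) := by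
        refine ENNReal.tsum_le_tsum fun i => ?_
        rw [← ENNReal.tsum_mul_left]
        refine ENNReal.tsum_le_tsum fun x => ?_
        by_cases h : p^[i] x = w ∧ i < gen x
        · rw [if_pos h, if_pos ⟨h.1, h.2.le⟩]
        · rw [if_neg h]
          exact bot_le
    _ ≤ ∑' i : ℕ, ((i : ℝ≥0∞) + 2) ^ 4 * (C * ϑ ^ i * M w) :=
        ENNReal.tsum_le_tsum fun i => mul_le_mul' le_rfl (hpack w i)
    _ = ∑' i : ℕ, (C * (((i : ℝ≥0∞) + 2) ^ 4 * ϑ ^ i)) * M w :=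
        tsum_congr fun i => by ring
    _ = (C * ∑' i : ℕ, ((i : ℝ≥0∞) + 2) ^ 4 * ϑ ^ i) * M w := by
        rw [ENNReal.tsum_mul_right, ENNReal.tsum_mul_left]

/-- The two series of the effective packing bounds are finite for `ϑ < 1`:
`Σⱼ ϑʲ < ∞`. [folklore] -/
theorem tsum_geometric_lt_top {ϑ : ℝ≥0∞} (hϑ : ϑ < 1) : ∑' j : ℕ, ϑ ^ j < ⊤ := by
  rw [ENNReal.tsum_geometric, ENNReal.inv_lt_top, tsub_pos_iff_lt]
  exact hϑ

/-- `Σᵢ (i+2)⁴ ϑⁱ < ∞` for `ϑ < 1`. [folklore] -/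
theorem tsum_pow_four_mul_geometric_lt_top {ϑ : ℝ≥0∞} (hϑ : ϑ < 1) :
    ∑' i : ℕ, ((i : ℝ≥0∞) + 2) ^ 4 * ϑ ^ i < ⊤ := by
  have hϑtop : ϑ ≠ ⊤ := (hϑ.trans ENNReal.one_lt_top).ne
  set t : ℝ≥0 := ϑ.toNNReal with ht
  have hϑt : ϑ = (t : ℝ≥0∞) := (ENNReal.coe_toNNReal hϑtop).symm
  have ht1 : t < 1 := by
    rw [hϑt] at hϑ
    exact_mod_cast hϑ
  -- compare with the summable real series `Σ (i+2)^4 t^i ≤ 16 Σ (i+1)^4 t^i`, itself dominated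
  -- by polynomial × geometric
  have hsum : Summable fun i : ℕ => ((i : ℝ≥0) + 2) ^ 4 * t ^ i := by
    have hr : ‖(t : ℝ)‖ < 1 := by
      rw [Real.norm_eq_abs, abs_of_nonneg t.coe_nonneg]
      exact_mod_cast ht1
    have h4 := summable_pow_mul_geometric_of_norm_lt_one 4 hr
    -- shift: (i+2)^4 t^i = t⁻²·(i+2)^4 t^{i+2}, but avoid division: bound (i+2)^4 ≤ 16 (i+1)^4 and
    -- use the shifted summable series `(i+1)^4 t^(i+1)`.
    have h5 : Summable fun i : ℕ => (((i + 1 : ℕ) : ℝ) ^ 4 * (t : ℝ) ^ (i + 1)) :=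
      (summable_nat_add_iff 1).2 h4
    have h6 : Summable fun i : ℕ => (16 : ℝ) * (((i + 1 : ℕ) : ℝ) ^ 4 * (t : ℝ) ^ (i + 1)) :=
      h5.mul_left 16
    rw [← NNReal.summable_coe]
    by_cases ht0 : t = 0
    · refine summable_of_ne_finset_zero (s := {0}) fun i hi => ?_
      rw [Finset.mem_singleton] at hi
      simp [ht0, hi]
    have htpos : (0 : ℝ) < t := by
      have : (0 : ℝ≥0) < t := pos_iff_ne_zero.2 ht0
      exact_mod_cast this
    refine Summable.of_nonneg_of_le (fun i => by positivity) (fun i => ?_) (h6.mul_left (t : ℝ)⁻¹)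
    push_cast
    have hi : ((i : ℝ) + 2) ^ 4 ≤ 16 * ((i : ℝ) + 1) ^ 4 := by
      have : (i : ℝ) + 2 ≤ 2 * ((i : ℝ) + 1) := by linarith
      calc ((i : ℝ) + 2) ^ 4 ≤ (2 * ((i : ℝ) + 1)) ^ 4 := pow_le_pow_left₀ (by positivity) this 4
        _ = 16 * ((i : ℝ) + 1) ^ 4 := by ring
    calc ((i : ℝ) + 2) ^ 4 * (t : ℝ) ^ i ≤ 16 * ((i : ℝ) + 1) ^ 4 * (t : ℝ) ^ i :=
          mul_le_mul_of_nonneg_right hi (by positivity)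
      _ = (t : ℝ)⁻¹ * (16 * (((i : ℝ) + 1) ^ 4 * (t : ℝ) ^ (i + 1))) := by
          field_simp
          ring
  rw [hϑt]
  have : ∑' i : ℕ, ((i : ℝ≥0∞) + 2) ^ 4 * (t : ℝ≥0∞) ^ i =
      ∑' i : ℕ, (((((i : ℝ≥0) + 2) ^ 4 * t ^ i : ℝ≥0)) : ℝ≥0∞) := by
    refine tsum_congr fun i => ?_
    push_cast
    rfl
  rw [this]
  exact lt_top_iff_ne_top.2 (ENNReal.tsum_coe_ne_top_iff_summable.2 hsum)

end Chain

end WhitneyChain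

/-! ## Per-generation packing for parent maps on a Whitney family -/

section Geometric

open Metric

variable {E : Type*} [NormedAddCommGroup E] [NormedSpace ℝ E] [FiniteDimensional ℝ E]

omit [NormedSpace ℝ E] [FiniteDimensional ℝ E] in
/-- **Chains shrink geometrically and stay close**: if the radii grow by `1 + θ` along parent
steps out of `big` and `dist(x, p x) ≤ K₁ ρ(x)`, then for a chain `x, p x, …, pʲ x = z` whose
first `j` members are outside `big`, `(1+θ)ʲ ρ(x) ≤ ρ(z)` and `dist(x, z) ≤ (K₁/θ) ρ(z)`. [folklore] -/
theorem chain_radius_dist_le {ι : Type*} (p : ι → ι) (big : Set ι) (c : ι → E) {ρ : ι → ℝ}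
    {θ K₁ : ℝ} (hθ : 0 < θ) (hK₁ : 0 ≤ K₁)
    (hgrow : ∀ x, x ∉ big → (1 + θ) * ρ x ≤ ρ (p x))
    (hdist : ∀ x, x ∉ big → dist (c x) (c (p x)) ≤ K₁ * ρ x)
    (j : ℕ) (x : ι) (hx : ∀ i, i < j → p^[i] x ∉ big) :
    (1 + θ) ^ j * ρ x ≤ ρ (p^[j] x) ∧
      dist (c x) (c (p^[j] x)) ≤ K₁ / θ * (ρ (p^[j] x) - ρ x) := by
  induction j with
  | zero => simp
  | succ j ih =>
    have hx' : ∀ i, i < j → p^[i] x ∉ big := fun i hi => hx i (Nat.lt_succ_of_lt hi)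
    obtain ⟨ih1, ih2⟩ := ih hx'
    have hj : p^[j] x ∉ big := hx j (Nat.lt_succ_self j)
    have hg := hgrow _ hj
    have hd := hdist _ hj
    rw [Function.iterate_succ_apply']
    have h1θ : 0 < 1 + θ := by linarith
    constructor
    · calc (1 + θ) ^ (j + 1) * ρ x = (1 + θ) * ((1 + θ) ^ j * ρ x) := by ring
        _ ≤ (1 + θ) * ρ (p^[j] x) := mul_le_mul_of_nonneg_left ih1 h1θ.le
        _ ≤ ρ (p (p^[j] x)) := hg
    · have hρj : ρ (p^[j] x) ≤ (ρ (p (p^[j] x)) - ρ (p^[j] x)) / θ := by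
        rw [le_div_iff₀ hθ]
        linarith
      calc dist (c x) (c (p (p^[j] x)))
          ≤ dist (c x) (c (p^[j] x)) + dist (c (p^[j] x)) (c (p (p^[j] x))) := dist_triangle _ _ _
        _ ≤ K₁ / θ * (ρ (p^[j] x) - ρ x) + K₁ * ρ (p^[j] x) := add_le_add ih2 hd
        _ ≤ K₁ / θ * (ρ (p^[j] x) - ρ x) + K₁ * ((ρ (p (p^[j] x)) - ρ (p^[j] x)) / θ) :=
            add_le_add le_rfl (mul_le_mul_of_nonneg_left hρj hK₁)
        _ = K₁ / θ * (ρ (p (p^[j] x)) - ρ x) := by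
            field_simp
            ring

/-- **Per-generation packing on a Whitney family** (dimension `3`): if the quarter balls
`B(x, ρ(x)/4)` of the centres `x ∈ S` are pairwise disjoint, the radii are positive and grow by
`1 + θ` along parent steps out of `big`, and `dist(x, p x) ≤ K₁ρ(x)`, then for every `z` and
generation `j`,
`Σ_{x : pʲx = z, chain outside big} ρ(x)⁴ ≤ (4K₁/θ + 5)³ (1+θ)^{-j} ρ(z)⁴`
(Tao 2011, p. 33: "If one fixes a large ball `Bⱼ`, one easily checks that
`Σ_{i : a(i) = j} rᵢ⁴ ≲ rⱼ⁴`" and "`Σ_k (1+k)^{10} Σ_{i : p^k(i) = j} rᵢ⁴ ≲ rⱼ⁴`"). [cite: Tao2011, §10, proof of Thm. 10.1 (parent-ball chaining, p. 33)] -/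
theorem tsum_pow_four_chain_le [Nontrivial E] (hE : Module.finrank ℝ E = 3) {S : Set E}
    (hS : S.Countable) {ρ : E → ℝ} (hdisj : S.PairwiseDisjoint fun x => ball x (ρ x / 4))
    (hposS : ∀ x ∈ S, 0 < ρ x) (p : S → S) (big : Set S) (gen : S → ℕ)
    (hgen1 : ∀ x i, i < gen x → p^[i] x ∉ big) {θ K₁ : ℝ} (hθ : 0 < θ) (hK₁ : 0 ≤ K₁)
    (hgrow : ∀ x : S, x ∉ big → (1 + θ) * ρ x ≤ ρ (p x))
    (hdist : ∀ x : S, x ∉ big → dist (x : E) (p x) ≤ K₁ * ρ x) [DecidableEq S] (z : S) (j : ℕ) :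
    ∑' x : S, (if p^[j] x = z ∧ j ≤ gen x then ENNReal.ofReal (ρ x ^ 4) else 0) ≤
      ENNReal.ofReal ((4 * (K₁ / θ) + 5) ^ 3) * ENNReal.ofReal ((1 + θ)⁻¹) ^ j *
        ENNReal.ofReal (ρ z ^ 4) := by
  have hpos : ∀ x : S, 0 < ρ x := fun x => hposS x x.2
  have h1θ : 0 < 1 + θ := by linarith
  set τ : ℝ := ((1 + θ)⁻¹) ^ j * ρ z with hτ
  have hτ0 : 0 ≤ τ := mul_nonneg (pow_nonneg (inv_nonneg.2 h1θ.le) j) (hpos z).le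
  have hKθ : 0 ≤ K₁ / θ := div_nonneg hK₁ hθ.le
  set R : ℝ := (K₁ / θ + 1) * ρ z with hR
  have hR0 : 0 ≤ R := mul_nonneg (by linarith) (hpos z).le
  -- chains ending at `z` after `j` steps are short and have small radius
  have hchain : ∀ x : S, p^[j] x = z ∧ j ≤ gen x → ρ x ≤ τ ∧ dist (x : E) z < R := by
    rintro x ⟨hxz, hjx⟩
    have hx : ∀ i, i < j → p^[i] x ∉ big := fun i hi => hgen1 x i (hi.trans_le hjx)
    obtain ⟨h1, h2⟩ := chain_radius_dist_le p big (fun x : S => (x : E)) hθ hK₁ hgrow hdist j x hx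
    rw [hxz] at h1 h2
    constructor
    · rw [hτ]
      have : ρ x ≤ ρ z / (1 + θ) ^ j := by
        rw [le_div_iff₀ (pow_pos h1θ j)]; linarith
      calc ρ x ≤ ρ z / (1 + θ) ^ j := this
        _ = ((1 + θ)⁻¹) ^ j * ρ z := by rw [inv_pow, div_eq_mul_inv, mul_comm]
    · calc dist (x : E) z ≤ K₁ / θ * (ρ z - ρ x) := h2
        _ < (K₁ / θ + 1) * ρ z := by nlinarith [hpos x, hpos z, div_nonneg hK₁ hθ.le]
  -- compare with the packing sum of `TaoWhitneyCover`
  have hpk := tsum_pow_radius_le (E := E) hS hdisj hposS (z : E) hR0 hτ0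
  rw [hE] at hpk
  calc ∑' x : S, (if p^[j] x = z ∧ j ≤ gen x then ENNReal.ofReal (ρ x ^ 4) else 0)
      ≤ ∑' x : S, (if dist (x : E) z < R ∧ ρ x ≤ τ then
          ENNReal.ofReal τ * ENNReal.ofReal (ρ x ^ 3) else 0) := by
        refine ENNReal.tsum_le_tsum fun x => ?_
        by_cases hx : p^[j] x = z ∧ j ≤ gen x
        · obtain ⟨hρτ, hdR⟩ := hchain x hx
          rw [if_pos hx, if_pos ⟨hdR, hρτ⟩, ← ENNReal.ofReal_mul hτ0]
          refine ENNReal.ofReal_le_ofReal ?_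
          rw [show ρ x ^ 4 = ρ x * ρ x ^ 3 by ring]
          exact mul_le_mul_of_nonneg_right hρτ (pow_nonneg (hpos x).le 3)
        · rw [if_neg hx]
          exact bot_le
    _ = ENNReal.ofReal τ * ∑' x : S, (if dist (x : E) z < R ∧ ρ x ≤ τ then
          ENNReal.ofReal (ρ x ^ 3) else 0) := by
        rw [← ENNReal.tsum_mul_left]
        refine tsum_congr fun x => ?_
        split_ifs <;> simp
    _ ≤ ENNReal.ofReal τ * ENNReal.ofReal ((4 * R + τ) ^ 3) := mul_le_mul' le_rfl hpk
    _ ≤ ENNReal.ofReal ((4 * (K₁ / θ) + 5) ^ 3) * ENNReal.ofReal ((1 + θ)⁻¹) ^ j *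
        ENNReal.ofReal (ρ z ^ 4) := by
        have eL : ENNReal.ofReal τ * ENNReal.ofReal ((4 * R + τ) ^ 3) =
            ENNReal.ofReal (τ * (4 * R + τ) ^ 3) := (ENNReal.ofReal_mul hτ0).symm
        have eR : ENNReal.ofReal ((4 * (K₁ / θ) + 5) ^ 3) * ENNReal.ofReal ((1 + θ)⁻¹) ^ j *
            ENNReal.ofReal (ρ z ^ 4) =
            ENNReal.ofReal ((4 * (K₁ / θ) + 5) ^ 3 * ((1 + θ)⁻¹) ^ j * ρ z ^ 4) := by
          rw [← ENNReal.ofReal_pow (inv_nonneg.2 h1θ.le),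
            ← ENNReal.ofReal_mul (pow_nonneg (by linarith) 3),
            ← ENNReal.ofReal_mul (mul_nonneg (pow_nonneg (by linarith) 3)
              (pow_nonneg (inv_nonneg.2 h1θ.le) j))]
        rw [eL, eR]
        refine ENNReal.ofReal_le_ofReal ?_
        have hτle : τ ≤ ρ z := by
          rw [hτ]
          have : ((1 + θ)⁻¹) ^ j ≤ 1 := pow_le_one₀ (inv_nonneg.2 h1θ.le) (inv_le_one_of_one_le₀ (by linarith))
          nlinarith [hpos z]
        have hz0 : 0 < ρ z := hpos z
        calc τ * (4 * R + τ) ^ 3 ≤ τ * (4 * R + ρ z) ^ 3 := by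
              refine mul_le_mul_of_nonneg_left (pow_le_pow_left₀ (by positivity) (by linarith) 3) hτ0
          _ = ((1 + θ)⁻¹) ^ j * ρ z * ((4 * (K₁ / θ) + 5) * ρ z) ^ 3 := by
              rw [hτ, hR]; ring
          _ = (4 * (K₁ / θ) + 5) ^ 3 * ((1 + θ)⁻¹) ^ j * ρ z ^ 4 := by ring

end Geometric

end Literature.Analysis.FluidPDE

end
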